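import Mathlib
import Summits.ValiantsHypothesis.ValiantsHypothesis.Theorems.KPlusLogSqLawWeakLiftingTowerGraftOperatorRoucheDominance

/-!
# Tower graft line — the LETTER-DOMINANT ZONE IS ROOT-FREE (matrix-level Rouché against the far letter)

Sequel to `…TowerGraftOperatorRouche.lean` / `…TowerGraftOperatorRoucheDominance.lean` (same seat; LINE (B) `Cruxes/WeakLifting/Lines/tower_graft.lean`,
crux `WeakLifting` = stmt-ValiantsHypothesis-19561; T1 instrument tier).  NO stub is claimed.

The base-dominant discs charge the roots of `det (G + Q)` to those of `det G` (prequel).  In the complementary zone, where the FAR LETTER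
`Q = X^D·S` dominates the base, the right homotopy is `Q + l·G`, `l ∈ [0,1]`, and the comparison determinant `det (X^D·S) = det S · X^{mD}` has
ALL its roots at `0`: so a disc of that zone not containing `0` carries NO root of `det (G + X^D·S)` at all (§1
`card_roots_det_add_eq_zero_of_letterHomotopy`; row-margin form `…_of_letterRowMargin`).  Together with the prequel: every positive root of a
graft determinant lies in the TRANSITION zone (neither homotopy non-singular on a surrounding circle) or is charged to a root of `det G` in a
base-dominant disc — the matrix-level form of the T-chain's «(E0) events + transition window» accounting, for far letters of every rank.
HONEST FRAMING: instrument; the transition zone is not counted here; nothing on S4/S4b/S5, TowerB, `WeakLifting`, B, 18050 or VP ≠ VNP.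
Def-free.  Seat: prover val-sym-lift-p2 g22, `--supports stmt-ValiantsHypothesis-19561 --as helper`.
-/

-- `Summit.ValiantsHypothesis.ValiantsHypothesis.…` repeats a component by the D-0017 layout
-- (single-conjunct summit), which the `dupNamespace` linter flags; the name is mandated.
set_option linter.dupNamespace false

namespace Summit.ValiantsHypothesis.ValiantsHypothesis.Theorems.KPlusLogSqLaw.TowerGraft

open Polynomial Complex
open scoped BigOperators Polynomial

section LetterZone

variable {n : Type*} [Fintype n] [DecidableEq n]

/-- the determinant of a monomial letter `X^D·S` is `det S · X^{D·|n|}`. [folklore] -/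
theorem det_X_pow_smul_map (S : Matrix n n ℂ) (D : ℕ) :
    ((X : ℂ[X]) ^ D • S.map C).det = C S.det * X ^ (D * Fintype.card n) := by
  rw [Matrix.det_smul, ← RingHom.mapMatrix_apply, ← RingHom.map_det, pow_mul, mul_comm]

/-- all roots of `det (X^D·S)` (`det S ≠ 0`) are at `0`: none lies in a disc avoiding `0`. [folklore] -/
theorem card_roots_det_X_pow_smul_eq_zero (S : Matrix n n ℂ) (hS : S.det ≠ 0) (D : ℕ) (c : ℂ) {R : ℝ} (hc : R ≤ dist 0 c) :
    Multiset.card ((((X : ℂ[X]) ^ D • S.map C).det).roots.filter fun z => dist z c < R) = 0 := by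
  rw [det_X_pow_smul_map, Polynomial.roots_C_mul _ hS, Polynomial.roots_X_pow, Multiset.card_eq_zero, Multiset.filter_eq_nil]
  intro z hz
  rw [Multiset.mem_nsmul] at hz
  rcases hz with ⟨_, hz⟩
  rw [Multiset.mem_singleton] at hz
  subst hz
  exact not_lt.mpr hc

/-- **THE LETTER-DOMINANT ZONE IS ROOT-FREE.**  `G` any square matrix polynomial over `ℂ`, far letter `X^D·S` with `det S ≠ 0`; a disc `B(c, R)`
with `0 ∉ B(c,R)` on whose circle the homotopy `X^D·S + l·G`, `l ∈ [0,1]`, is non-singular.  Then `det (G + X^D·S)` has NO root in the disc.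
[this work] -/
theorem card_roots_det_add_eq_zero_of_letterHomotopy (G : Matrix n n ℂ[X]) (S : Matrix n n ℂ) (hS : S.det ≠ 0) (D : ℕ)
    (c : ℂ) {R : ℝ} (hR : 0 < R) (hc : R ≤ dist 0 c)
    (hne : ∀ l : ℝ, 0 ≤ l → l ≤ 1 → ∀ τ ∈ Metric.sphere c R,
      ((((X : ℂ[X]) ^ D • S.map C) + Polynomial.C (l : ℂ) • G).det).eval τ ≠ 0) :
    Multiset.card ((G + (X : ℂ[X]) ^ D • S.map C).det.roots.filter fun z => dist z c < R) = 0 := by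
  have h := card_roots_det_add_eq_of_homotopy ((X : ℂ[X]) ^ D • S.map C) G c hR hne
  rw [add_comm] at h
  rw [h]
  exact card_roots_det_X_pow_smul_eq_zero S hS D c hc

/-- **row-margin form.**  If on the circle of a disc avoiding `0` the far letter's rows dominate:
`Σ_{j ≠ k} (|τ|^D·‖S k j‖ + ‖G k j(τ)‖) + ‖G k k(τ)‖ < |τ|^D·‖S k k‖` for every `k`, then `det (G + X^D·S)` has no root in the disc. [this work] -/
theorem card_roots_det_add_eq_zero_of_letterRowMargin (G : Matrix n n ℂ[X]) (S : Matrix n n ℂ) (hS : S.det ≠ 0) (D : ℕ)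
    (c : ℂ) {R : ℝ} (hR : 0 < R) (hc : R ≤ dist 0 c)
    (h : ∀ τ ∈ Metric.sphere c R, ∀ k,
      (∑ j ∈ Finset.univ.erase k, (‖τ‖ ^ D * ‖S k j‖ + ‖(G k j).eval τ‖)) + ‖(G k k).eval τ‖ < ‖τ‖ ^ D * ‖S k k‖) :
    Multiset.card ((G + (X : ℂ[X]) ^ D • S.map C).det.roots.filter fun z => dist z c < R) = 0 := by
  refine card_roots_det_add_eq_zero_of_letterHomotopy G S hS D c hR hc fun l hl0 hl1 τ hτ => ?_
  refine eval_det_homotopy_ne_zero_of_rowMargin _ _ τ (fun k => ?_) hl0 hl1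
  have hentry : ∀ i j, ‖(((X : ℂ[X]) ^ D • S.map C) i j).eval τ‖ = ‖τ‖ ^ D * ‖S i j‖ := by
    intro i j
    rw [Matrix.smul_apply, Matrix.map_apply, smul_eq_mul, eval_mul, eval_pow, eval_X, eval_C, norm_mul, norm_pow]
  simp only [hentry]
  exact h τ hτ k

end LetterZone

end Summit.ValiantsHypothesis.ValiantsHypothesis.Theorems.KPlusLogSqLaw.TowerGraft
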